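import Summits.QuantumFields.YangMills.Theorems.UnitScaleTiltProp7TwistedSliceTangent
import Summits.QuantumFields.YangMills.Theorems.UnitScaleTiltProp7SymFrameUnitary
import Summits.QuantumFields.YangMills.Theorems.UnitScaleTiltProp7FibreELOfTangentCriticalSU2
import Summits.QuantumFields.YangMills.Theorems.UnitScaleTiltProp7FibreELOfCritSplit
import HarnessLib

/-!
# Route `UnitScaleTilt`, crux «MinimiserStabilityRegPr» (stmt-QuantumFields-19200, stub EX `stub_existenceMinimalOrbit`, route (α)) — «FRAME-RESPONSE-SU2» (brick (4) of ★px5 g3's LOCATE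
# «SPLIT127-BRIDGE» 7bbec079a9aa70ab, the bridge `hSplit′ ⟹ hSplit127` for ✓`Prop7Crit127OfCrit93Split`): **THE RIGHT-TRIVIALISED RESPONSE OF THE SYMMETRIC FRAME TOWER TO A REAL CHART
# DIRECTION IS `𝔰𝔲(2)`-VALUED** — for `U₀ ∈ 𝔘_k(ε₀)`, `A₁`, `α` skew-Hermitian-traceless, `‖A₁‖ < e·η`: T2's letter `λ_α(y) := (D w_y)(A₁)[α]·w_y(A₁)⁻¹` satisfies `λ_α(y)ᴴ = −λ_α(y)`,
# `tr λ_α(y) = 0` (the frames `w_y(A₁ + tα)` are `SU(2)`-valued for real `t` ✓`Prop7SymFrameBound.frameTwS_mem_specialUnitaryUnits_of_regPr`, so `t ↦ w_y(A₁ + tα)·w_y(A₁)^*` is a curve in the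
# closed group `SU(2)` through `1`, whose velocity lies in `𝔰𝔲(2)` ✓`MatrixLie.mem_lieSet_of_hasDerivAt`).

Cell `ym3-torus` (HUMAN RULING D-0037, YM ladder rung R3 — YM₃ on T³, NOT d = 4, NOT Clay; YM gap NOT proved), width seat `ym3-torus-px21` gen 3 (explicit-unit helper; lineage px21 g0∕g2∕g3;
EX namer ★w2-19200 g7 word (8), px5's split «px21 takes (4)»).  THEOREMS ONLY (0 `def`, 0 `sorry`); `--supports stmt-QuantumFields-19200 --as helper`, count-neutral; NO claim on crux ∕ stub.

THE PRINT.  [Balaban1985Averaging] (87)–(92) p. 31, (97) p. 32 (the symmetric accumulated frames are products of averaged `G`-valued transports — group-valued); [Balaban1985Variational] (51) p. 286,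
(123)–(126) pp. 296–297 (the gauge transformations relating the `f`-fibres are `G`-valued, their generators `𝔤`-valued).  In the bridge (px5 memo §1 step (4)) `λ_α` is the infinitesimal gauge
parameter `Ñ ⊇ λ_α` of ✓`Prop7TwistedSliceGaugeCorrection.exists_gaugeDir_QSym_velocity_sub_eq_zero_of_slice_tangent` (T3); its reality is what makes `ξ′ := Mα − 𝒢_{U′}(Ñ)` a legal (real)
input of the display's `hSplit′`.
WHAT IS PROVED (member `F`, `K n`, `h : n ≤ K`; ns `…Theorems.Prop7FrameResponseSU2`):
* §1 `star_mem_specialUnitaryGroup` (`u ∈ SU(2) ⇒ uᴴ ∈ SU(2)`), `smul_I_negI_smul` (`i•((−i)•Z) = Z` bondwise), `frameTwS_real_mem_specialUnitaryGroup` (for skew-Hermitian-traceless `A` with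
  `‖A‖ ≤ e·η` bondwise: `↑(frameTwS U₀ A y) ∈ SU(2)` — ✓`frameTwS_mem_specialUnitaryUnits_of_regPr` read at `X := (−i)•A`).
* §2 ★★★ `frameResponse_skew_traceless` — THE BRICK: `star λ_α(y) = −λ_α(y) ∧ tr λ_α(y) = 0` in T2's letters (`fderiv ℂ (fun A ↦ ↑(frameTwS F n K h U₀ A y)) A₁ α * ↑(frameTwS … A₁ y)⁻¹`).
HONEST SCOPE.  Lie-group bookkeeping over landed letters (frame unitarity, frame analyticity, the closed-subgroup velocity lemma); no estimate; not the bridge itself (px5's pen); not a proof of any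
stub; nothing continuum ∕ OS ∕ mass-gap ∕ Clay.
-/

set_option autoImplicit false

noncomputable section

open scoped Matrix.Norms.L2Operator Matrix Topology
open Filter Metric NormedSpace

namespace Summit.QuantumFields.YangMills.Theorems.Prop7FrameResponseSU2

open Literature.MathematicalPhysics.QuantumFieldTheory.Balaban1983to89
open Literature.MathematicalPhysics.QuantumFieldTheory.Balaban1983to89.T3ContinuumYM3Torus
open Literature.RepresentationTheory.CompactGroups (MatrixLie.mem_lieSet_of_hasDerivAt MatrixLie.mem_lieSet)
open T3PrintedRegularMinimiser (RegPr)
open T3SectALandauChart (eta eta_pos)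
open Summit.QuantumFields.YangMills.Theorems.Prop7SymAvgTwSym (frameTwS)
open Summit.QuantumFields.YangMills.Theorems.Prop7SymFrameBound (frameTwS_mem_specialUnitaryUnits_of_regPr)
open Summit.QuantumFields.YangMills.Theorems.Prop7TwistedSliceTangent (hasFDerivAt_frameTwS_at_of_regPr)
open Summit.QuantumFields.YangMills.Theorems.Prop7FibreELOfCritSplit (skew_add_real_smul)

variable (F : T3Family) {n K : ℕ} (h : n ≤ K)

/-! ## §1 Bookkeeping: `SU(2)` is closed under `ᴴ`; the frames at a real exponent field are `SU(2)`-valued -/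

/-- `u ∈ SU(2) ⟹ star u ∈ SU(2)`. [folklore] -/
theorem star_mem_specialUnitaryGroup {u : Matrix (Fin 2) (Fin 2) ℂ} (hu : u ∈ Matrix.specialUnitaryGroup (Fin 2) ℂ) : star u ∈ Matrix.specialUnitaryGroup (Fin 2) ℂ := by
  rw [Matrix.mem_specialUnitaryGroup_iff] at hu ⊢
  refine ⟨Unitary.star_mem hu.1, ?_⟩
  rw [Matrix.star_eq_conjTranspose, Matrix.det_conjTranspose, hu.2, star_one]

/-- `i • ((−i) • Z) = Z` bondwise, as functions. [folklore] -/
theorem smul_I_negI_smul (A : PBond (F.P K) 0 → Matrix (Fin 2) (Fin 2) ℂ) : (fun b => Complex.I • (((-Complex.I) • A) b)) = A := by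
  funext b
  rw [Pi.smul_apply, smul_smul, mul_neg, Complex.I_mul_I, neg_neg, one_smul]

/-- **THE SYMMETRIC FRAMES AT A REAL EXPONENT FIELD ARE `SU(2)`-VALUED**: for `U₀ ∈ 𝔘_k(ε₀)` (`10¹²L³ε₀ ≤ 1`, `10⁹L²e ≤ 1`) and `A` skew-Hermitian-traceless with `‖A(b)‖ ≤ e·η`,
`↑(frameTwS U₀ A y) ∈ SU(2)` (✓`frameTwS_mem_specialUnitaryUnits_of_regPr` at `X := (−i)•A`). [cite: Balaban1985Averaging, (87)–(92) p.31, (97) p.32; Balaban1985Variational, (51) p.286] -/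
theorem frameTwS_real_mem_specialUnitaryGroup {ε₀ e : ℝ} (hε₀ : 0 < ε₀) (he : 0 ≤ e) (hWε : 10 ^ 12 * (F.L : ℝ) ^ 3 * ε₀ ≤ 1) (hWe : 10 ^ 9 * (F.L : ℝ) ^ 2 * e ≤ 1)
    (U₀ : GaugeField (F.P K) 0 (Matrix.specialUnitaryGroup (Fin 2) ℂ)) (hreg : RegPr F n K ε₀ U₀)
    {A : PBond (F.P K) 0 → Matrix (Fin 2) (Fin 2) ℂ} (hAR : ∀ b, star (A b) = -A b ∧ (A b).trace = 0) (hAb : ∀ b, ‖A b‖ ≤ e * eta F n K) (y : Site (F.P n) 0) :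
    ((frameTwS F n K h U₀ A y : (Matrix (Fin 2) (Fin 2) ℂ)ˣ) : Matrix (Fin 2) (Fin 2) ℂ) ∈ Matrix.specialUnitaryGroup (Fin 2) ℂ := by
  have hsa : ∀ b, IsSelfAdjoint (((-Complex.I) • A) b) := fun b => by
    rw [IsSelfAdjoint, Pi.smul_apply, star_smul, (hAR b).1, star_neg, Complex.star_def, Complex.conj_I, neg_neg, smul_neg, neg_smul]
  have htr : ∀ b, Matrix.trace (((-Complex.I) • A) b) = 0 := fun b => by rw [Pi.smul_apply, Matrix.trace_smul, (hAR b).2, smul_zero]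
  have hnb : ∀ b, ‖((-Complex.I) • A) b‖ ≤ e * eta F n K := fun b => by
    rw [Pi.smul_apply, norm_smul, norm_neg, Complex.norm_I, one_mul]; exact hAb b
  have hmem := frameTwS_mem_specialUnitaryUnits_of_regPr F h hε₀ he hWε hWe U₀ hreg ((-Complex.I) • A) hsa htr hnb y
  rw [smul_I_negI_smul] at hmem
  exact B7Prop2SpecialUnitary.mem_specialUnitaryUnits.1 hmem

/-! ## §2 ★★★ The frame response to a real direction is `𝔰𝔲(2)`-valued -/

/-- ★★★ **`λ_α(y) ∈ 𝔰𝔲(2)`** — for `U₀ ∈ 𝔘_k(ε₀)` (`10⁹L²e ≤ 1`, `10¹²L³ε₀ ≤ 1`), `A₁`, `α` skew-Hermitian-traceless with `‖A₁‖ < e·η`, T2's frame response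
`λ_α(y) := fderiv ℂ (fun A ↦ ↑(frameTwS U₀ A y)) A₁ α * ↑(frameTwS U₀ A₁ y)⁻¹` is skew-Hermitian and traceless: `t ↦ ↑w_y(A₁ + tα)·(↑w_y(A₁))ᴴ` runs in `SU(2)` for small real `t`
(§1 along ✓`skew_add_real_smul`), equals `1` at `t = 0`, and has velocity `λ_α(y)` there (✓`hasFDerivAt_frameTwS_at_of_regPr`; `(↑w)⁻¹ = (↑w)ᴴ` on `SU(2)`); the closed-subgroup velocity lemma
✓`MatrixLie.mem_lieSet_of_hasDerivAt` + ✓`mem_su_iff_forall_exp_mem_specialUnitaryGroup` conclude.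
[cite: Balaban1985Averaging, (97) p.32, (87)–(92) p.31; Balaban1985Variational, (51) p.286, (123)–(126) pp.296–297; Hall2015, Prop. 3.24, Cor. 3.45] -/
theorem frameResponse_skew_traceless {ε₀ e : ℝ} (hε₀ : 0 < ε₀) (he : 0 < e) (hWe : 10 ^ 9 * (F.L : ℝ) ^ 2 * e ≤ 1) (hWε : 10 ^ 12 * (F.L : ℝ) ^ 3 * ε₀ ≤ 1)
    (U₀ : GaugeField (F.P K) 0 (Matrix.specialUnitaryGroup (Fin 2) ℂ)) (hreg : RegPr F n K ε₀ U₀) {A₁ α : PBond (F.P K) 0 → Matrix (Fin 2) (Fin 2) ℂ}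
    (hA₁ : ‖A₁‖ < e * eta F n K) (hA₁R : ∀ b, star (A₁ b) = -A₁ b ∧ (A₁ b).trace = 0) (hαR : ∀ b, star (α b) = -α b ∧ (α b).trace = 0) (y : Site (F.P n) 0) :
    star (fderiv ℂ (fun A : PBond (F.P K) 0 → Matrix (Fin 2) (Fin 2) ℂ => ((frameTwS F n K h U₀ A y : (Matrix (Fin 2) (Fin 2) ℂ)ˣ) : Matrix (Fin 2) (Fin 2) ℂ)) A₁ α *
        (((frameTwS F n K h U₀ A₁ y)⁻¹ : (Matrix (Fin 2) (Fin 2) ℂ)ˣ) : Matrix (Fin 2) (Fin 2) ℂ))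
      = -(fderiv ℂ (fun A : PBond (F.P K) 0 → Matrix (Fin 2) (Fin 2) ℂ => ((frameTwS F n K h U₀ A y : (Matrix (Fin 2) (Fin 2) ℂ)ˣ) : Matrix (Fin 2) (Fin 2) ℂ)) A₁ α *
        (((frameTwS F n K h U₀ A₁ y)⁻¹ : (Matrix (Fin 2) (Fin 2) ℂ)ˣ) : Matrix (Fin 2) (Fin 2) ℂ)) ∧
    Matrix.trace (fderiv ℂ (fun A : PBond (F.P K) 0 → Matrix (Fin 2) (Fin 2) ℂ => ((frameTwS F n K h U₀ A y : (Matrix (Fin 2) (Fin 2) ℂ)ˣ) : Matrix (Fin 2) (Fin 2) ℂ)) A₁ α *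
        (((frameTwS F n K h U₀ A₁ y)⁻¹ : (Matrix (Fin 2) (Fin 2) ℂ)ˣ) : Matrix (Fin 2) (Fin 2) ℂ)) = 0 := by
  -- letters
  set w : (PBond (F.P K) 0 → Matrix (Fin 2) (Fin 2) ℂ) → Matrix (Fin 2) (Fin 2) ℂ :=
    fun A => ((frameTwS F n K h U₀ A y : (Matrix (Fin 2) (Fin 2) ℂ)ˣ) : Matrix (Fin 2) (Fin 2) ℂ) with hw
  have hA₁b : ∀ b, ‖A₁ b‖ ≤ e * eta F n K := fun b => (norm_le_pi_norm A₁ b).trans hA₁.le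
  -- the base frame is `SU(2)`: `(↑w)⁻¹ = star ↑w`
  have h0mem : w A₁ ∈ Matrix.specialUnitaryGroup (Fin 2) ℂ := frameTwS_real_mem_specialUnitaryGroup F h hε₀ he.le hWε hWe U₀ hreg hA₁R hA₁b y
  have hstar1 : star (w A₁) * w A₁ = 1 := (Matrix.mem_unitaryGroup_iff').1 (Matrix.mem_specialUnitaryGroup_iff.1 h0mem).1
  have h1star : w A₁ * star (w A₁) = 1 := (Matrix.mem_unitaryGroup_iff).1 (Matrix.mem_specialUnitaryGroup_iff.1 h0mem).1
  have hinv : (((frameTwS F n K h U₀ A₁ y)⁻¹ : (Matrix (Fin 2) (Fin 2) ℂ)ˣ) : Matrix (Fin 2) (Fin 2) ℂ) = star (w A₁) := by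
    rw [Matrix.coe_units_inv]
    exact Matrix.inv_eq_left_inv hstar1
  rw [hinv]
  -- the curve `γ(t) := ↑w(A₁ + tα) · (↑w(A₁))ᴴ`
  set γ : ℝ → Matrix (Fin 2) (Fin 2) ℂ := fun t => w (A₁ + (t : ℂ) • α) * star (w A₁) with hγ
  -- it runs in `SU(2)` for small `t`
  have hline : HasDerivAt (fun t : ℝ => A₁ + (t : ℂ) • α) α 0 := by
    have h1 := ((Complex.ofRealCLM.hasDerivAt (x := (0 : ℝ))).smul_const α).const_add A₁
    simpa only [Complex.ofRealCLM_apply, Complex.ofReal_one, one_smul] using h1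
  have hball : ∀ᶠ t : ℝ in 𝓝 0, ‖A₁ + (t : ℂ) • α‖ < e * eta F n K :=
    (hline.continuousAt.norm).eventually_lt continuousAt_const (by simpa only [Complex.ofReal_zero, zero_smul, add_zero] using hA₁)
  have hS : ∀ᶠ t : ℝ in 𝓝 0, γ t ∈ (Matrix.specialUnitaryGroup (Fin 2) ℂ : Set (Matrix (Fin 2) (Fin 2) ℂ)) := by
    filter_upwards [hball] with t ht
    have hmem : w (A₁ + (t : ℂ) • α) ∈ Matrix.specialUnitaryGroup (Fin 2) ℂ :=
      frameTwS_real_mem_specialUnitaryGroup F h hε₀ he.le hWε hWe U₀ hreg (skew_add_real_smul hA₁R hαR t) (fun b => (norm_le_pi_norm _ b).trans ht.le) y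
    exact Submonoid.mul_mem _ hmem (star_mem_specialUnitaryGroup h0mem)
  have hγ0 : γ 0 = 1 := by
    simp only [hγ, Complex.ofReal_zero, zero_smul, add_zero]
    exact h1star
  -- its velocity at `0` is `λ_α(y)`
  have hγ' : HasDerivAt γ (fderiv ℂ w A₁ α * star (w A₁)) 0 := by
    have hF := hasFDerivAt_frameTwS_at_of_regPr F h hε₀ he hWe hWε U₀ hreg hA₁b y
    have h0 : A₁ = (fun t : ℝ => A₁ + (t : ℂ) • α) 0 := by simp only [Complex.ofReal_zero, zero_smul, add_zero]
    have h1 := (hF.restrictScalars ℝ).comp_hasDerivAt_of_eq (0 : ℝ) hline h0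
    have h2 : HasDerivAt (fun t : ℝ => w (A₁ + (t : ℂ) • α)) (fderiv ℂ w A₁ α) 0 := by
      simpa only [Function.comp_def, ContinuousLinearMap.coe_restrictScalars'] using h1
    exact h2.mul_const (star (w A₁))
  -- closed-subgroup velocity lemma
  have hlie := MatrixLie.mem_lieSet_of_hasDerivAt B12SemisimpleNormalTori.isClosedUnitaryGroup_specialUnitaryGroup hS hγ0 hγ'
  rw [MatrixLie.mem_lieSet] at hlie
  exact (LogChartClosedSubgroup.mem_su_iff_forall_exp_mem_specialUnitaryGroup (n := Fin 2)).2 hlie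

end Summit.QuantumFields.YangMills.Theorems.Prop7FrameResponseSU2

end
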